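import Literature.NumberTheory.GaloisRepresentations.SelmerStructureOnePlaceComparisonProofs
import Literature.NumberTheory.GaloisCohomology.KolyvaginSystems
import HarnessLib

/-!
# Howard's `F^q(n)`, `F_q(n)`, `F(n)`, `F(nq)` as `SelmerStructure.modify`: the `loc_q` identifications
# of Howard 2004 §1.5 at a level (proofs file)

Topic `NumberTheory/GaloisCohomology` (sequel to `KolyvaginSystems`: `SelmerStructure.modify 𝓕 𝒯 a b c =
𝓕^a_b(c)`, and to `GaloisRepresentations/SelmerStructureOnePlaceComparisonProofs`: Selmer groups of
structures agreeing off one place).  THEOREMS ONLY: no definition, no named fact, no instance, no `sorry`.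

For a Selmer structure `𝓕`, transverse conditions `𝒯`, a finite set of primes `n` and a prime `q` (with
`q ∉ n` where stated), the four structures of Howard's §1.5 in the tree's `modify` dialect
(`SelmerTriple.modify/atLevel` unfold to these with `𝒯 = transverseStructure p ρ jbar`):
`F^q(n) = 𝓕.modify 𝒯 {q} ∅ n` (relaxed at `q`), `F_q(n) = 𝓕.modify 𝒯 ∅ {q} n` (strict at `q`),
`F(n) = 𝓕.modify 𝒯 ∅ ∅ n`, `F(nq) = 𝓕.modify 𝒯 ∅ ∅ (insert q n)`.  §1: they agree off `q`, with values
`⊤ / ⊥ / 𝓕_q / 𝒯_q` at `q`.  §2: with `𝓗^q(n) ⊇ 𝓗(n), 𝓗(nq) ⊇ 𝓗_q(n)` their Selmer groups,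
`loc = loc_q` and `A = loc(𝓗^q(n))`:
* `𝓗_q(n) = 𝓗^q(n) ∩ ker loc = 𝓗(n) ∩ ker loc = 𝓗(nq) ∩ ker loc`;
* `𝓗(n) = 𝓗^q(n) ∩ loc⁻¹(𝓕_q)`, `𝓗(nq) = 𝓗^q(n) ∩ loc⁻¹(𝒯_q)`;
* **`loc(𝓗(n)) = A ∩ 𝓕_q`** («`A_f`»), **`loc(𝓗(nq)) = A ∩ 𝒯_q`** («`A_tr`»);
* `𝓗(n)/𝓗_q(n) ≃+ A ∩ 𝓕_q`, `𝓗(nq)/𝓗_q(n) ≃+ A ∩ 𝒯_q`, `𝓗^q(n)/𝓗_q(n) ≃+ A`;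
* `#𝓗(n) = #𝓗_q(n) · #(A ∩ 𝓕_q)`, `#𝓗(nq) = #𝓗_q(n) · #(A ∩ 𝒯_q)`, `#𝓗^q(n) = #𝓗_q(n) · #A`;
* given `𝓕_q ∩ 𝒯_q = 0` (Prop. 1.1.9, a hypothesis): a class of `𝓗(nq)` finite at `q`, or of `𝓗(n)` transverse
  at `q`, is locally zero at `q` (`localization_eq_zero_of_mem_selmerGroup_modify_insert/_level`).
The `R`-module forms (lengths, `r • 𝓗 ≤ ker loc ↔ r • (A ∩ C) = 0`) are the prequel's §2 applied with the
agreement lemmas of §1 here.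

WHY (cell `pub/bsd-print-x9`, G87 = Howard 2004 Thm. 1.6.1, print leaf `stub_h161` of
stmt-BirchSwinnertonDyer-22642; seat `bsd-line-x9-p1-w3` g14, brick (LOC-ID), file 3/3).  B. Howard,
Compositio Math. 140 (2004) §1.5 (arXiv:1202.6340 §2.5, p. 10 L1–4, L98–104, L133–145; p. 11 L3–9).
BSD is not proved by any of this.
-/

set_option autoImplicit false

noncomputable section

open NumberField

universe u

namespace Literature.NumberTheory.GaloisRepresentations.DiscreteGaloisModule.SelmerStructure

open Literature.NumberTheory.GaloisRepresentations

variable {K : Type u} [Field K] [NumberField K] {M : Type u} [AddCommGroup M]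
  [TopologicalSpace M] [DiscreteTopology M] {ρ : DiscreteGaloisModule K M}

/-! ## §1 The four structures agree off `q` -/

section Modify

open scoped Classical

variable (𝓕 𝒯 : SelmerStructure ρ) (a b c : Finset (IsDedekindDomain.HeightOneSpectrum (𝓞 K)))
  (q : IsDedekindDomain.HeightOneSpectrum (𝓞 K))

/-- Relaxing at `q` does not change the structure off `q`.
[cite: Howard2004HeegnerKolyvagin, Def. 1.2.2 (arXiv:1202.6340 Def. 2.2.2, p. 6 L101–125)] -/
theorem modify_insert_relaxed_apply_of_ne {v : Place K} (hv : v ≠ Sum.inr q) :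
    𝓕.modify 𝒯 (insert q a) b c v = 𝓕.modify 𝒯 a b c v := by
  cases v with
  | inl w' => rfl
  | inr q' =>
    have hq : q' ≠ q := fun h => hv (by rw [h])
    simp [modify_inr, hq]

/-- Making strict at `q` does not change the structure off `q`.
[cite: Howard2004HeegnerKolyvagin, Def. 1.2.2 (arXiv:1202.6340 Def. 2.2.2, p. 6 L101–125)] -/
theorem modify_insert_strict_apply_of_ne {v : Place K} (hv : v ≠ Sum.inr q) :
    𝓕.modify 𝒯 a (insert q b) c v = 𝓕.modify 𝒯 a b c v := by
  cases v with
  | inl w' => rfl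
  | inr q' =>
    have hq : q' ≠ q := fun h => hv (by rw [h])
    simp [modify_inr, hq]

/-- Imposing the transverse condition at `q` does not change the structure off `q`.
[cite: Howard2004HeegnerKolyvagin, Def. 1.2.2 (arXiv:1202.6340 Def. 2.2.2, p. 6 L101–125)] -/
theorem modify_insert_transverse_apply_of_ne {v : Place K} (hv : v ≠ Sum.inr q) :
    𝓕.modify 𝒯 a b (insert q c) v = 𝓕.modify 𝒯 a b c v := by
  cases v with
  | inl w' => rfl
  | inr q' =>
    have hq : q' ≠ q := fun h => hv (by rw [h])
    simp [modify_inr, hq]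

/-- At `q`, the structure relaxed at `q` is everything.
[cite: Howard2004HeegnerKolyvagin, Def. 1.2.2 (arXiv:1202.6340 Def. 2.2.2, p. 6 L110–112)] -/
theorem modify_insert_relaxed_apply_self : 𝓕.modify 𝒯 (insert q a) b c (Sum.inr q) = ⊤ :=
  modify_inr_of_mem_relaxed 𝓕 𝒯 (Finset.mem_insert_self q a)

/-- At `q ∉ a`, the structure made strict at `q` is zero.
[cite: Howard2004HeegnerKolyvagin, Def. 1.2.2 (arXiv:1202.6340 Def. 2.2.2, p. 6 L112–114)] -/
theorem modify_insert_strict_apply_self (hqa : q ∉ a) :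
    𝓕.modify 𝒯 a (insert q b) c (Sum.inr q) = ⊥ :=
  modify_inr_of_mem_strict 𝓕 𝒯 hqa (Finset.mem_insert_self q b)

/-- At `q ∉ a ∪ b`, the structure made transverse at `q` is `𝒯_q`.
[cite: Howard2004HeegnerKolyvagin, Def. 1.2.2 (arXiv:1202.6340 Def. 2.2.2, p. 6 L114–120)] -/
theorem modify_insert_transverse_apply_self (hqa : q ∉ a) (hqb : q ∉ b) :
    𝓕.modify 𝒯 a b (insert q c) (Sum.inr q) = 𝒯 (Sum.inr q) :=
  modify_inr_of_mem_transverse 𝓕 𝒯 hqa hqb (Finset.mem_insert_self q c)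

variable (n : Finset (IsDedekindDomain.HeightOneSpectrum (𝓞 K)))

/-- `F(n)` agrees with `F^q(n)` off `q`. [cite: Howard2004HeegnerKolyvagin, Def. 1.2.2 (arXiv:1202.6340 p. 6 L101–125)] -/
theorem modify_level_eq_relaxed_of_ne (v : Place K) (hv : v ≠ Sum.inr q) :
    𝓕.modify 𝒯 ∅ ∅ n v = 𝓕.modify 𝒯 {q} ∅ n v := by
  rw [← Finset.insert_empty, modify_insert_relaxed_apply_of_ne 𝓕 𝒯 ∅ ∅ n q hv]

/-- `F_q(n)` agrees with `F^q(n)` off `q`. [cite: Howard2004HeegnerKolyvagin, Def. 1.2.2 (arXiv:1202.6340 p. 6 L101–125)] -/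
theorem modify_strict_eq_relaxed_of_ne (v : Place K) (hv : v ≠ Sum.inr q) :
    𝓕.modify 𝒯 ∅ {q} n v = 𝓕.modify 𝒯 {q} ∅ n v := by
  rw [← Finset.insert_empty, modify_insert_strict_apply_of_ne 𝓕 𝒯 ∅ ∅ n q hv,
    modify_insert_relaxed_apply_of_ne 𝓕 𝒯 ∅ ∅ n q hv]

/-- `F(nq)` agrees with `F^q(n)` off `q`. [cite: Howard2004HeegnerKolyvagin, Def. 1.2.2 (arXiv:1202.6340 p. 6 L101–125)] -/
theorem modify_insert_level_eq_relaxed_of_ne (v : Place K) (hv : v ≠ Sum.inr q) :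
    𝓕.modify 𝒯 ∅ ∅ (insert q n) v = 𝓕.modify 𝒯 {q} ∅ n v := by
  rw [modify_insert_transverse_apply_of_ne 𝓕 𝒯 ∅ ∅ n q hv, ← Finset.insert_empty,
    modify_insert_relaxed_apply_of_ne 𝓕 𝒯 ∅ ∅ n q hv]

/-- `F^q(n)_q = H¹(K_q, T)`. [cite: Howard2004HeegnerKolyvagin, Def. 1.2.2 (arXiv:1202.6340 p. 6 L110–112)] -/
theorem modify_relaxed_apply_self : 𝓕.modify 𝒯 {q} ∅ n (Sum.inr q) = ⊤ :=
  modify_inr_of_mem_relaxed 𝓕 𝒯 (Finset.mem_singleton_self q)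

/-- `F_q(n)_q = 0`. [cite: Howard2004HeegnerKolyvagin, Def. 1.2.2 (arXiv:1202.6340 p. 6 L112–114)] -/
theorem modify_strict_apply_self : 𝓕.modify 𝒯 ∅ {q} n (Sum.inr q) = ⊥ :=
  modify_inr_of_mem_strict 𝓕 𝒯 (Finset.notMem_empty q) (Finset.mem_singleton_self q)

/-- `F(n)_q = 𝓕_q` for `q ∉ n`. [cite: Howard2004HeegnerKolyvagin, Def. 1.2.2 (arXiv:1202.6340 p. 6 L121–123)] -/
theorem modify_level_apply_self (hq : q ∉ n) : 𝓕.modify 𝒯 ∅ ∅ n (Sum.inr q) = 𝓕 (Sum.inr q) :=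
  modify_inr_of_not_mem 𝓕 𝒯 (Finset.notMem_empty q) (Finset.notMem_empty q) hq

/-- `F(nq)_q = 𝒯_q`. [cite: Howard2004HeegnerKolyvagin, Def. 1.2.2 (arXiv:1202.6340 p. 6 L114–120)] -/
theorem modify_insert_level_apply_self :
    𝓕.modify 𝒯 ∅ ∅ (insert q n) (Sum.inr q) = 𝒯 (Sum.inr q) :=
  modify_inr_of_mem_transverse 𝓕 𝒯 (Finset.notMem_empty q) (Finset.notMem_empty q)
    (Finset.mem_insert_self q n)

/-! ## §2 The Selmer groups `𝓗^q(n) ⊇ 𝓗(n), 𝓗(nq) ⊇ 𝓗_q(n)` and the local image `A` -/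

/-- **`𝓗_q(n) = 𝓗^q(n) ∩ ker loc_q`** (`0 → H¹_{F_q(n)} → H¹_{F^q(n)} → H¹(K_q, T)` is exact).
[cite: Howard2004HeegnerKolyvagin, §1.5 (arXiv:1202.6340 §2.5, p. 10 L1–4)] -/
theorem selmerGroup_modify_strict_eq :
    (𝓕.modify 𝒯 ∅ {q} n).selmerGroup = (𝓕.modify 𝒯 {q} ∅ n).selmerGroup ⊓
      (galoisCohomology.localization ρ (Sum.inr q) 1).ker :=
  selmerGroup_eq_inf_ker_of_eq_bot_of_eq_off (modify_relaxed_apply_self 𝓕 𝒯 q n)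
    (modify_strict_apply_self 𝓕 𝒯 q n) (modify_strict_eq_relaxed_of_ne 𝓕 𝒯 q n)

/-- **`𝓗(n) = 𝓗^q(n) ∩ loc_q⁻¹(𝓕_q)`** for `q ∉ n` (`0 → H¹_{F(n)} → H¹_{F^q(n)} → H¹(K_q, T)/𝓕_q`).
[cite: Howard2004HeegnerKolyvagin, §1.5 (arXiv:1202.6340 §2.5, p. 10 L1–4)] -/
theorem selmerGroup_modify_level_eq (hq : q ∉ n) :
    (𝓕.modify 𝒯 ∅ ∅ n).selmerGroup = (𝓕.modify 𝒯 {q} ∅ n).selmerGroup ⊓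
      (𝓕 (Sum.inr q)).comap (galoisCohomology.localization ρ (Sum.inr q) 1) := by
  rw [← modify_level_apply_self 𝓕 𝒯 q n hq]
  exact selmerGroup_eq_inf_comap_of_eq_off (modify_relaxed_apply_self 𝓕 𝒯 q n)
    (modify_level_eq_relaxed_of_ne 𝓕 𝒯 q n)

/-- **`𝓗(nq) = 𝓗^q(n) ∩ loc_q⁻¹(𝒯_q)`** (`0 → H¹_{F(nq)} → H¹_{F^q(n)} → H¹(K_q, T)/H¹_tr`).
[cite: Howard2004HeegnerKolyvagin, §1.5 (arXiv:1202.6340 §2.5, p. 10 L1–4)] -/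
theorem selmerGroup_modify_insert_level_eq :
    (𝓕.modify 𝒯 ∅ ∅ (insert q n)).selmerGroup = (𝓕.modify 𝒯 {q} ∅ n).selmerGroup ⊓
      (𝒯 (Sum.inr q)).comap (galoisCohomology.localization ρ (Sum.inr q) 1) := by
  rw [← modify_insert_level_apply_self 𝓕 𝒯 q n]
  exact selmerGroup_eq_inf_comap_of_eq_off (modify_relaxed_apply_self 𝓕 𝒯 q n)
    (modify_insert_level_eq_relaxed_of_ne 𝓕 𝒯 q n)

/-- **`loc_q(𝓗(n)) = A ∩ 𝓕_q`** («`A_f`»), `A = loc_q(𝓗^q(n))`, for `q ∉ n`.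
[cite: Howard2004HeegnerKolyvagin, Lemma 1.5.7 (proof) (arXiv:1202.6340 Lemma 2.5.7, p. 10 L98–104)] -/
theorem map_localization_selmerGroup_modify_level_eq (hq : q ∉ n) :
    (𝓕.modify 𝒯 ∅ ∅ n).selmerGroup.map (galoisCohomology.localization ρ (Sum.inr q) 1) =
      (𝓕.modify 𝒯 {q} ∅ n).selmerGroup.map (galoisCohomology.localization ρ (Sum.inr q) 1) ⊓
        𝓕 (Sum.inr q) := by
  rw [← modify_level_apply_self 𝓕 𝒯 q n hq]
  exact map_localization_selmerGroup_eq_of_eq_off (modify_relaxed_apply_self 𝓕 𝒯 q n)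
    (modify_level_eq_relaxed_of_ne 𝓕 𝒯 q n)

/-- **`loc_q(𝓗(nq)) = A ∩ 𝒯_q`** («`A_tr`»), `A = loc_q(𝓗^q(n))`.
[cite: Howard2004HeegnerKolyvagin, Lemma 1.5.7 (proof) (arXiv:1202.6340 Lemma 2.5.7, p. 10 L98–104)] -/
theorem map_localization_selmerGroup_modify_insert_level_eq :
    (𝓕.modify 𝒯 ∅ ∅ (insert q n)).selmerGroup.map (galoisCohomology.localization ρ (Sum.inr q) 1) =
      (𝓕.modify 𝒯 {q} ∅ n).selmerGroup.map (galoisCohomology.localization ρ (Sum.inr q) 1) ⊓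
        𝒯 (Sum.inr q) := by
  rw [← modify_insert_level_apply_self 𝓕 𝒯 q n]
  exact map_localization_selmerGroup_eq_of_eq_off (modify_relaxed_apply_self 𝓕 𝒯 q n)
    (modify_insert_level_eq_relaxed_of_ne 𝓕 𝒯 q n)

/-- `𝓗_q(n) = 𝓗(n) ∩ ker loc_q` for `q ∉ n` (`0 → H¹_{F_q(n)} → H¹_{F(n)} → H¹_f(K_q, T)` is exact).
[cite: Howard2004HeegnerKolyvagin, §1.5 (arXiv:1202.6340 §2.5, p. 10 L1–4)] -/
theorem selmerGroup_modify_strict_eq_level_inf_ker :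
    (𝓕.modify 𝒯 ∅ {q} n).selmerGroup = (𝓕.modify 𝒯 ∅ ∅ n).selmerGroup ⊓
      (galoisCohomology.localization ρ (Sum.inr q) 1).ker :=
  selmerGroup_eq_selmerGroup_inf_ker_of_eq_off (modify_relaxed_apply_self 𝓕 𝒯 q n)
    (modify_level_eq_relaxed_of_ne 𝓕 𝒯 q n) (modify_strict_apply_self 𝓕 𝒯 q n)
    (modify_strict_eq_relaxed_of_ne 𝓕 𝒯 q n)

/-- `𝓗_q(n) = 𝓗(nq) ∩ ker loc_q` (`0 → H¹_{F_q(n)} → H¹_{F(nq)} → H¹_tr(K_q, T)` is exact).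
[cite: Howard2004HeegnerKolyvagin, §1.5 (arXiv:1202.6340 §2.5, p. 10 L1–4 and L20–22)] -/
theorem selmerGroup_modify_strict_eq_insert_level_inf_ker :
    (𝓕.modify 𝒯 ∅ {q} n).selmerGroup = (𝓕.modify 𝒯 ∅ ∅ (insert q n)).selmerGroup ⊓
      (galoisCohomology.localization ρ (Sum.inr q) 1).ker :=
  selmerGroup_eq_selmerGroup_inf_ker_of_eq_off (modify_relaxed_apply_self 𝓕 𝒯 q n)
    (modify_insert_level_eq_relaxed_of_ne 𝓕 𝒯 q n) (modify_strict_apply_self 𝓕 𝒯 q n)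
    (modify_strict_eq_relaxed_of_ne 𝓕 𝒯 q n)

/-- **A class of `𝓗(nq)` whose localisation at `q` is finite (`∈ 𝓕_q`) is locally ZERO at `q`**, given
`𝓕_q ∩ 𝒯_q = 0` — the input «`H¹_f(K_λ, T) ∩ H¹_tr(K_λ, T) = 0`» of Prop. 1.1.9 (the local splitting, a
hypothesis here): the localisation of a level-`nq` Selmer class lies in the transverse condition `𝒯_q`.  This is
the hypothesis `hdisj` of the (ks)-relation reading `Howard2004/KolyvaginRelationLocalizationProofs`.
[cite: Howard2004HeegnerKolyvagin, Prop. 1.1.9 and §1.5 (arXiv:1202.6340 Prop. 2.1.9, p. 6 L17–25; p. 10 L1–4)] -/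
theorem localization_eq_zero_of_mem_selmerGroup_modify_insert
    (hdisj : Disjoint (𝓕 (Sum.inr q)) (𝒯 (Sum.inr q))) {c : galoisCohomology ρ 1}
    (hc : c ∈ (𝓕.modify 𝒯 ∅ ∅ (insert q n)).selmerGroup)
    (hf : galoisCohomology.localization ρ (Sum.inr q) 1 c ∈ 𝓕 (Sum.inr q)) :
    galoisCohomology.localization ρ (Sum.inr q) 1 c = 0 := by
  have htr : galoisCohomology.localization ρ (Sum.inr q) 1 c ∈ 𝒯 (Sum.inr q) := by
    rw [← modify_insert_level_apply_self 𝓕 𝒯 q n]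
    exact (mem_selmerGroup_iff _ c).1 hc (Sum.inr q)
  rw [← AddSubgroup.mem_bot, ← hdisj.eq_bot]
  exact AddSubgroup.mem_inf.2 ⟨hf, htr⟩

/-- Dually: a class of `𝓗(n)` (`q ∉ n`) whose localisation at `q` is transverse (`∈ 𝒯_q`) is locally zero at
`q`, given `𝓕_q ∩ 𝒯_q = 0`.
[cite: Howard2004HeegnerKolyvagin, Prop. 1.1.9 and §1.5 (arXiv:1202.6340 Prop. 2.1.9, p. 6 L17–25; p. 10 L1–4)] -/
theorem localization_eq_zero_of_mem_selmerGroup_modify_level (hq : q ∉ n)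
    (hdisj : Disjoint (𝓕 (Sum.inr q)) (𝒯 (Sum.inr q))) {c : galoisCohomology ρ 1}
    (hc : c ∈ (𝓕.modify 𝒯 ∅ ∅ n).selmerGroup)
    (htr : galoisCohomology.localization ρ (Sum.inr q) 1 c ∈ 𝒯 (Sum.inr q)) :
    galoisCohomology.localization ρ (Sum.inr q) 1 c = 0 := by
  have hf : galoisCohomology.localization ρ (Sum.inr q) 1 c ∈ 𝓕 (Sum.inr q) := by
    rw [← modify_level_apply_self 𝓕 𝒯 q n hq]
    exact (mem_selmerGroup_iff _ c).1 hc (Sum.inr q)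
  rw [← AddSubgroup.mem_bot, ← hdisj.eq_bot]
  exact AddSubgroup.mem_inf.2 ⟨hf, htr⟩

/-- **`𝓗(n)/𝓗_q(n) ≃+ A ∩ 𝓕_q`** («the lower left quotient ≅ `A_f`»), `q ∉ n`.
[cite: Howard2004HeegnerKolyvagin, Lemma 1.5.8 (arXiv:1202.6340 Lemma 2.5.8, p. 10 L133–145)] -/
theorem nonempty_quotient_level_addEquiv (hq : q ∉ n) :
    Nonempty (↥(𝓕.modify 𝒯 ∅ ∅ n).selmerGroup ⧸
        (𝓕.modify 𝒯 ∅ {q} n).selmerGroup.addSubgroupOf (𝓕.modify 𝒯 ∅ ∅ n).selmerGroup ≃+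
      ↥((𝓕.modify 𝒯 {q} ∅ n).selmerGroup.map (galoisCohomology.localization ρ (Sum.inr q) 1) ⊓
        𝓕 (Sum.inr q))) := by
  rw [← modify_level_apply_self 𝓕 𝒯 q n hq]
  exact nonempty_quotient_addEquiv_map_inf_of_eq_off (modify_relaxed_apply_self 𝓕 𝒯 q n)
    (modify_level_eq_relaxed_of_ne 𝓕 𝒯 q n) (modify_strict_apply_self 𝓕 𝒯 q n)
    (modify_strict_eq_relaxed_of_ne 𝓕 𝒯 q n)

/-- **`𝓗(nq)/𝓗_q(n) ≃+ A ∩ 𝒯_q`** («the lower right quotient ≅ `A_tr`»).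
[cite: Howard2004HeegnerKolyvagin, Lemma 1.5.8 (arXiv:1202.6340 Lemma 2.5.8, p. 10 L133–145)] -/
theorem nonempty_quotient_insert_level_addEquiv :
    Nonempty (↥(𝓕.modify 𝒯 ∅ ∅ (insert q n)).selmerGroup ⧸
        (𝓕.modify 𝒯 ∅ {q} n).selmerGroup.addSubgroupOf (𝓕.modify 𝒯 ∅ ∅ (insert q n)).selmerGroup ≃+
      ↥((𝓕.modify 𝒯 {q} ∅ n).selmerGroup.map (galoisCohomology.localization ρ (Sum.inr q) 1) ⊓
        𝒯 (Sum.inr q))) := by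
  rw [← modify_insert_level_apply_self 𝓕 𝒯 q n]
  exact nonempty_quotient_addEquiv_map_inf_of_eq_off (modify_relaxed_apply_self 𝓕 𝒯 q n)
    (modify_insert_level_eq_relaxed_of_ne 𝓕 𝒯 q n) (modify_strict_apply_self 𝓕 𝒯 q n)
    (modify_strict_eq_relaxed_of_ne 𝓕 𝒯 q n)

/-- **`𝓗^q(n)/𝓗_q(n) ≃+ A`** («Localization at `q` gives an isomorphism» onto the local image).
[cite: Howard2004HeegnerKolyvagin, Lemma 1.5.7 (proof) (arXiv:1202.6340 Lemma 2.5.7, p. 10 L98–104)] -/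
theorem nonempty_quotient_relaxed_addEquiv :
    Nonempty (↥(𝓕.modify 𝒯 {q} ∅ n).selmerGroup ⧸
        (𝓕.modify 𝒯 ∅ {q} n).selmerGroup.addSubgroupOf (𝓕.modify 𝒯 {q} ∅ n).selmerGroup ≃+
      ↥((𝓕.modify 𝒯 {q} ∅ n).selmerGroup.map (galoisCohomology.localization ρ (Sum.inr q) 1))) := by
  obtain ⟨e⟩ := nonempty_quotient_addEquiv_map_inf_of_eq_off (𝓖 := 𝓕.modify 𝒯 {q} ∅ n)
    (modify_relaxed_apply_self 𝓕 𝒯 q n) (fun _ _ => rfl) (modify_strict_apply_self 𝓕 𝒯 q n)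
    (modify_strict_eq_relaxed_of_ne 𝓕 𝒯 q n)
  rw [modify_relaxed_apply_self, inf_top_eq] at e
  exact ⟨e⟩

/-- **`#𝓗(n) = #𝓗_q(n) · #(A ∩ 𝓕_q)`**, `q ∉ n`.
[cite: Howard2004HeegnerKolyvagin, Lemma 1.5.8 (arXiv:1202.6340 Lemma 2.5.8, p. 10 L133–145)] -/
theorem natCard_selmerGroup_modify_level_eq (hq : q ∉ n) :
    Nat.card ↥(𝓕.modify 𝒯 ∅ ∅ n).selmerGroup = Nat.card ↥(𝓕.modify 𝒯 ∅ {q} n).selmerGroup *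
      Nat.card ↥((𝓕.modify 𝒯 {q} ∅ n).selmerGroup.map
        (galoisCohomology.localization ρ (Sum.inr q) 1) ⊓ 𝓕 (Sum.inr q)) := by
  rw [← modify_level_apply_self 𝓕 𝒯 q n hq]
  exact natCard_selmerGroup_eq_mul_of_eq_off (modify_relaxed_apply_self 𝓕 𝒯 q n)
    (modify_level_eq_relaxed_of_ne 𝓕 𝒯 q n) (modify_strict_apply_self 𝓕 𝒯 q n)
    (modify_strict_eq_relaxed_of_ne 𝓕 𝒯 q n)

/-- **`#𝓗(nq) = #𝓗_q(n) · #(A ∩ 𝒯_q)`**.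
[cite: Howard2004HeegnerKolyvagin, Lemma 1.5.8 (arXiv:1202.6340 Lemma 2.5.8, p. 10 L133–145)] -/
theorem natCard_selmerGroup_modify_insert_level_eq :
    Nat.card ↥(𝓕.modify 𝒯 ∅ ∅ (insert q n)).selmerGroup =
      Nat.card ↥(𝓕.modify 𝒯 ∅ {q} n).selmerGroup *
      Nat.card ↥((𝓕.modify 𝒯 {q} ∅ n).selmerGroup.map
        (galoisCohomology.localization ρ (Sum.inr q) 1) ⊓ 𝒯 (Sum.inr q)) := by
  rw [← modify_insert_level_apply_self 𝓕 𝒯 q n]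
  exact natCard_selmerGroup_eq_mul_of_eq_off (modify_relaxed_apply_self 𝓕 𝒯 q n)
    (modify_insert_level_eq_relaxed_of_ne 𝓕 𝒯 q n) (modify_strict_apply_self 𝓕 𝒯 q n)
    (modify_strict_eq_relaxed_of_ne 𝓕 𝒯 q n)

/-- **`#𝓗^q(n) = #𝓗_q(n) · #A`**.
[cite: Howard2004HeegnerKolyvagin, Lemma 1.5.6 (proof, the length count) (arXiv:1202.6340 Lemma 2.5.6, p. 10 L86–92)] -/
theorem natCard_selmerGroup_modify_relaxed_eq :
    Nat.card ↥(𝓕.modify 𝒯 {q} ∅ n).selmerGroup = Nat.card ↥(𝓕.modify 𝒯 ∅ {q} n).selmerGroup *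
      Nat.card ↥((𝓕.modify 𝒯 {q} ∅ n).selmerGroup.map
        (galoisCohomology.localization ρ (Sum.inr q) 1)) :=
  natCard_selmerGroup_eq_mul_of_eq_top (modify_relaxed_apply_self 𝓕 𝒯 q n)
    (modify_strict_apply_self 𝓕 𝒯 q n) (modify_strict_eq_relaxed_of_ne 𝓕 𝒯 q n)

end Modify

end Literature.NumberTheory.GaloisRepresentations.DiscreteGaloisModule.SelmerStructure

end
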